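import Summits.HodgeConjecture.CorCM.MumfordTateRankTypeIVTimesTwoCMCurves
import Summits.HodgeConjecture.CorCM.MumfordTateRankThree
import Summits.HodgeConjecture.CorCM.MumfordTateRankSquareRootsIndependent
import Summits.HodgeConjecture.CorCM.AndreRiemannBiproducts
import Summits.HodgeConjecture.CorCM.Assembly.CMEllipticCurvesIsogenyFields
import Literature.AlgebraicGeometry.Motives.HodgeStructureOfAbelianVarietyBiproduct
import HarnessLib

/-!
# `Lie Hg(H¹(E₀ × ⋯ × E_m))` for CM elliptic curves of pairwise distinct fields: spanned by the blocks `χ̂_j = π_j^* χ_j^* ι_j^*`, abelian of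
# dimension `m + 1`, and TWISTED-RIGID for every slope in `i√d·ℚ` with `d` outside the square classes of the `d_j` (Besicovitch)

COR-CM (cell `pub-hodgecm2`, seat `b27` gen 51, count-neutral Mumford–Tate-rank ladder; theorems only, no definition, no named fact;
UNCONDITIONAL — nothing here uses or asserts HC_CM).  Notation `t(X) = dim MT(H¹X) = dim Lie Hg(H¹X) + 1`.

SETTING.  `E : Fin (m+1) → AV` elliptic curves with `χ_j ∘ χ_j = −d_j` (`d_j > 0`) and `d_i ≠ s² d_j` (`i ≠ j`, `s ∈ ℚ`: pairwise distinct CM fields,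
hence pairwise non-isogenous); `H = H¹(⨁ E)` with the Hodge endomorphisms `χ̂_j = π_j^* ∘ χ_j^* ∘ ι_j^*` (biproduct maps; `ι_j^* π_j^* = id`,
`ι_i^* π_j^* = 0`, `Σ_j π_j^* ι_j^* = id`: `Motives/HodgeStructureOfAbelianVarietyBiproduct`).
* §1 **`hodgeLie_hodge_one_biproduct_cmCurves_eq_span`** — `Lie Hg(H) = span_ℚ{χ̂_j}` (`⊆`: an element of `Lie Hg(H)` commutes with the Hodge
  idempotents `π_j^* ι_j^*`, so it is the sum of its diagonal blocks, each in `Lie Hg(H¹E_j) ⊆ ℚχ_j^*` (`RankTwoCM`); `=` by `t(⨁ E) = m + 2`,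
  Kubota, `CorCM/MumfordTateRankThree`); **`…_comm_and_finrank`** — `Lie Hg(H)` is abelian of dimension `m + 1`.
* §2 **`hodgeLie_hodge_one_biproduct_cmCurves_le_of_resonance`** — for a Hodge operator `Θ` of `H`, `T ∈ ℚ^×`, `d > 0`, `r ∈ ℚ` with (`r = 0` or
  `d ≠ s² d_j` for all `j, s`), `K ≤ Lie Hg(H)` rational and `y₀ ∈ Lie Hg(H)`: `T·Θ − (2i√d·r)·(y₀)_ℂ ∈ K_ℂ ⟹ Lie Hg(H) ≤ K`.  PROOF: if
  `v ∈ Lie Hg(H) ∖ K`, a rational functional `f` kills `K` but not `v`; `Λ(Z) = Σ_j (f(χ̂_j)/tr(χ̂_j²)) tr(Z χ̂_j,ℂ)` agrees with `f` on `Lie Hg(H)`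
  (trace-orthogonality of the `χ̂_j`), so kills `K_ℂ`; `tr(Θ χ̂_j,ℂ) = tr(Θ_{E_j} χ_j,ℂ^*) = ±2i√d_j` (`trace_theta_mul_baseChange_pullback_eq`) and
  `tr((y₀)_ℂ χ̂_j,ℂ) ∈ ℚ`, so `Λ` of the resonance is a vanishing rational combination of `√d_0, …, √d_m, √d`: all coefficients vanish
  (`CorCM/MumfordTateRankSquareRootsIndependent`), `f(χ̂_j) = 0` for all `j`, `f(v) = 0` — contradiction.  This is the hypothesis `hrig` of
  `Motives/HodgeLieTimesCMSummand` §6 for the summand `H¹(E₀ × ⋯ × E_m)` against a centre `ℚφ`, `φ² = −d` (`tr(Θ_A φ_ℂ) = 2i√d(n₊ − n₋)`); the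
  tower theorem `t(A × E₀ × ⋯ × E_m) = t(A) + m + 1` is drawn in `CorCM/MumfordTateRankTypeIVTimesCMCurvesTower`.

## References
* [MoonenZarhin1999LowDim] B. Moonen, Yu. G. Zarhin, *Hodge classes on abelian varieties of low dimension*, Math. Ann. 315 (1999), §3 (3.1), Lemma (3.6),
  Prop. (3.8) [corpus: paper:arxiv-math_9901113 pp. 6–7]. [cite: MoonenZarhin1999LowDim, §3 Lemma (3.6) and Prop. (3.8)]
* [Besicovitch1940] A. S. Besicovitch, *On the linear independence of fractional powers of integers*, J. London Math. Soc. 15 (1940) 3–6. [cite: Besicovitch1940, Thm. 1]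
* [Deligne1982HodgeCycles] P. Deligne, *Hodge cycles on abelian varieties*, LNM 900 (1982), I §3 Prop. 3.4 and Prop. 3.6. [cite: Deligne1982HodgeCycles, I §3 Prop. 3.6]
* [Gordon1999HodgeAVSurvey] B. B. Gordon, *A survey of the Hodge conjecture for abelian varieties*, 7.5, 7.6.1. [cite: Gordon1999HodgeAVSurvey, 7.5 and 7.6.1]
-/

noncomputable section

open scoped TensorProduct BigOperators
open CategoryTheory CategoryTheory.Limits Module

namespace Summit.HodgeConjecture.CorCM

open Literature.AlgebraicGeometry.Motives
open Literature.AlgebraicGeometry.Motives.AbelianVariety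
open Literature.AlgebraicGeometry.Motives.HodgeStructure
open Literature.AlgebraicGeometry.HodgeTheory
open Literature.AlgebraicGeometry.ComplexMultiplication
open Literature.AlgebraicGeometry.Milne1999 (IsOfCMType)

variable [HodgeTensorFacts.{0, 0}] {m : ℕ} {E : Fin (m + 1) → AbelianVariety ℂ} {k : ℕ}

/-! ## §0 Distinct CM fields: non-square ratios ⟹ non-isogenous -/

omit [HodgeTensorFacts.{0, 0}] in
/-- **CM elliptic curves with `χ ∘ χ = −d`, `χ' ∘ χ' = −d'` and `d ≠ s²d'` for all rational `s` are NOT isogenous** (`E ∼ E'` iff `dd'` is a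
square). [cite: MoonenZarhin1999LowDim, §2 (2.1) and §3 Lemma (3.3)] -/
theorem not_isIsogenous_of_forall_ne_sq_mul {C C' : AbelianVariety ℂ} (hC1 : C.dim = 1) (hC'1 : C'.dim = 1) {χ : C ⟶ C} {χ' : C' ⟶ C'}
    {d d' : ℕ} (hd : 0 < d) (hd' : 0 < d') (hχ : χ ≫ χ = -(d • 𝟙 C)) (hχ' : χ' ≫ χ' = -(d' • 𝟙 C'))
    (hfree : ∀ s : ℚ, (d : ℚ) ≠ s ^ 2 * d') : ¬ IsIsogenous C C' := by
  intro h
  obtain ⟨r, hr⟩ := (PeriodCurve.isIsogenous_iff_isSquare_of_cm hC1 hC'1 hd hd' hχ hχ').1 h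
  have hd'Q : (d' : ℚ) ≠ 0 := by exact_mod_cast hd'.ne'
  have hrQ : (d : ℚ) * d' = r * r := by exact_mod_cast hr
  refine hfree (r / d') ?_
  field_simp
  linear_combination hrQ

/-! ## §1 `Lie Hg(H¹(⨁ E)) = span{χ̂_j}`, abelian of dimension `m + 1` -/

/-- **`Lie Hg(H¹(E₀ × ⋯ × E_m)) = span_ℚ{χ̂_0, …, χ̂_m}`**, `χ̂_j = π_j^* ∘ χ_j^* ∘ ι_j^*`, for elliptic curves with `χ_j ∘ χ_j = −d_j` and pairwise
non-square ratios `d_i/d_j` (blocks of an element of `Lie Hg` lie in `Lie Hg(H¹E_j) ⊆ ℚχ_j^*`; equality by `t(⨁ E) = m + 2`, Kubota).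
[cite: MoonenZarhin1999LowDim, §3 (3.1) and Prop. (3.8)] [cite: Gordon1999HodgeAVSurvey, 7.5 and 7.6.1] -/
theorem hodgeLie_hodge_one_biproduct_cmCurves_eq_span (hY : IsSmoothProjective k (⨁ E).X) (hE1 : ∀ j, (E j).dim = 1)
    (χ : ∀ j, E j ⟶ E j) (d : Fin (m + 1) → ℕ) (hd : ∀ j, 0 < d j) (hχ : ∀ j, χ j ≫ χ j = -(d j • 𝟙 (E j)))
    (hfree : ∀ i j, i ≠ j → ∀ s : ℚ, (d i : ℚ) ≠ s ^ 2 * d j) :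
    haveI := BettiUniverse.finite hY 1
    (BettiUniverse.hodge exists_isReal_hodgeModel_holds hY 1).hodgeLie =
      Submodule.span ℚ (Set.range fun j : Fin (m + 1) =>
        BettiUniverse.pull (biproduct.π E j).hom.hom.hom 1 ∘ₗ (bettiCohomology.map (χ j).hom.hom.hom 1).hom ∘ₗ
          BettiUniverse.pull (biproduct.ι E j).hom.hom.hom 1) ∧
    Module.finrank ℚ (BettiUniverse.hodge exists_isReal_hodgeModel_holds hY 1).hodgeLie = m + 1 := by
  classical
  have hkY : (⨁ E).dim = k := schemeDim_eq_holds hY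
  subst hkY
  haveI := BettiUniverse.finite hY 1
  have hEsp : ∀ j, IsSmoothProjective (E j).dim (E j).X := fun j => AbelianVariety.isSmoothProjective_holds
  haveI : ∀ j, Module.Finite ℚ (bettiCohomology (E j).X 1) := fun j => BettiUniverse.finite (hEsp j) 1
  let ιY : ∀ j, Hom (BettiUniverse.hodge exists_isReal_hodgeModel_holds (hEsp j) 1) (BettiUniverse.hodge exists_isReal_hodgeModel_holds hY 1) :=
    fun j => BettiUniverse.pullHodgeHom exists_isReal_hodgeModel_holds hodgePQ_independent_of_hodgeModel_holds hY (hEsp j)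
      (biproduct.π E j).hom.hom.hom 1
  let πY : ∀ j, Hom (BettiUniverse.hodge exists_isReal_hodgeModel_holds hY 1) (BettiUniverse.hodge exists_isReal_hodgeModel_holds (hEsp j) 1) :=
    fun j => BettiUniverse.pullHodgeHom exists_isReal_hodgeModel_holds hodgePQ_independent_of_hodgeModel_holds (hEsp j) hY
      (biproduct.ι E j).hom.hom.hom 1
  have hπι : ∀ j v, (πY j).toLinearMap ((ιY j).toLinearMap v) = v := fun j v => pull_biproduct_ι_π_self E j v
  have hsum : ∀ v, ∑ j, (ιY j).toLinearMap ((πY j).toLinearMap v) = v := fun v => sum_pull_biproduct_π_ι E v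
  set χQ : ∀ j, Module.End ℚ (bettiCohomology (E j).X 1) := fun j => (bettiCohomology.map (χ j).hom.hom.hom 1).hom with hχQ
  set b : Fin (m + 1) → Module.End ℚ (bettiCohomology (⨁ E).X 1) := fun j =>
    BettiUniverse.pull (biproduct.π E j).hom.hom.hom 1 ∘ₗ (bettiCohomology.map (χ j).hom.hom.hom 1).hom ∘ₗ
      BettiUniverse.pull (biproduct.ι E j).hom.hom.hom 1 with hb
  have hbj : ∀ j, b j = (ιY j).toLinearMap ∘ₗ χQ j ∘ₗ (πY j).toLinearMap := fun j => rfl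
  obtain ⟨ψE⟩ : Nonempty (∀ j, (BettiUniverse.hodge exists_isReal_hodgeModel_holds (hEsp j) 1).Polarization) :=
    ⟨fun j => (BettiUniverse.hodge_isPolarizable exists_isReal_hodgeModel_holds (hEsp j) 1).some⟩
  have hχE : ∀ j, χQ j ∈ (BettiUniverse.hodge exists_isReal_hodgeModel_holds (hEsp j) 1).endAlg := fun j =>
    pullback_mem_endAlg exists_isReal_hodgeModel_holds hodgePQ_independent_of_hodgeModel_holds (χ j)
  have hχ2 : ∀ j, χQ j * χQ j = -((d j : ℚ) • 1) := fun j => bettiMapHom_mul_self (hχ j)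
  have hV : ∀ j, Module.finrank ℚ (bettiCohomology (E j).X 1) = 2 := fun j => by rw [finrank_bettiCohomology_one (E j), hE1 j]
  have heff : ∀ j, (BettiUniverse.hodge exists_isReal_hodgeModel_holds (hEsp j) 1).IsEffective := fun j =>
    BettiUniverse.hodge_isEffective exists_isReal_hodgeModel_holds (hEsp j) 1
  have h𝔥E : ∀ j, (BettiUniverse.hodge exists_isReal_hodgeModel_holds (hEsp j) 1).hodgeLie ≤ ℚ ∙ χQ j := by
    intro j R hR
    obtain ⟨c, hc⟩ := RankTwoCM.exists_eq_ratCast_smul_of_commute_of_skew _ Nat.cast_one (heff j) (hV j) (ψE j) (hχE j)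
      (Nat.cast_pos.2 (hd j)) (hχ2 j) (commute_of_mem_hodgeLie _ hR ⟨_, hχE j⟩) (form_apply_add_eq_zero_of_mem_hodgeLie (ψE j) hR)
    exact Submodule.mem_span_singleton.2 ⟨c, hc.symm⟩
  have heE : ∀ j, (ιY j).toLinearMap ∘ₗ (πY j).toLinearMap ∈ (BettiUniverse.hodge exists_isReal_hodgeModel_holds hY 1).endAlg := by
    intro j
    have h := comp_mem_endAlg_of_hom _ _ (πY j) (ιY j) (Subalgebra.one_mem (BettiUniverse.hodge exists_isReal_hodgeModel_holds (hEsp j) 1).endAlg)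
    rwa [Module.End.one_eq_id, LinearMap.id_comp] at h
  have hle : (BettiUniverse.hodge exists_isReal_hodgeModel_holds hY 1).hodgeLie ≤ Submodule.span ℚ (Set.range b) := by
    intro X hX
    have hblk : ∀ j, ∃ c : ℚ, (πY j).toLinearMap ∘ₗ X ∘ₗ (ιY j).toLinearMap = c • χQ j := fun j =>
      Submodule.mem_span_singleton.1 (h𝔥E j (comp_mem_hodgeLie_of_retract (ιY j) (πY j) (hπι j) hX)) |>.imp fun c hc => hc.symm
    choose c hc using hblk
    have hXe : ∀ j, X ∘ₗ ((ιY j).toLinearMap ∘ₗ (πY j).toLinearMap) = c j • b j := by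
      intro j
      have hcomm := commute_of_mem_hodgeLie _ hX ⟨_, heE j⟩
      change X * ((ιY j).toLinearMap ∘ₗ (πY j).toLinearMap) = ((ιY j).toLinearMap ∘ₗ (πY j).toLinearMap) * X at hcomm
      rw [hbj, ← LinearMap.comp_smul, ← LinearMap.smul_comp, ← hc j]
      refine LinearMap.ext fun v => ?_
      have h1 := LinearMap.congr_fun hcomm ((ιY j).toLinearMap ((πY j).toLinearMap v))
      simp only [Module.End.mul_apply, LinearMap.comp_apply, hπι] at h1
      simp only [LinearMap.comp_apply]
      exact h1
    have hXsum : X = ∑ j, c j • b j := by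
      refine LinearMap.ext fun v => ?_
      conv_lhs => rw [← hsum v]
      rw [map_sum, LinearMap.sum_apply]
      refine Finset.sum_congr rfl fun j _ => ?_
      have h := LinearMap.congr_fun (hXe j) v
      simpa only [LinearMap.comp_apply] using h
    rw [hXsum]
    exact Submodule.sum_mem _ fun j _ => Submodule.smul_mem _ _ (Submodule.subset_span ⟨j, rfl⟩)
  have hcm : ∀ j, IsOfCMType (E j) := fun j => (isOfCMType_and_mtRank_eq_two_of_curve_of_comp_self_eq_neg (hEsp j) (hE1 j) (χ j) (hd j) (hχ j)).1
  have hniso : ∀ i j, i ≠ j → ¬ IsIsogenous (E i) (E j) := fun i j hij =>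
    not_isIsogenous_of_forall_ne_sq_mul (hE1 i) (hE1 j) (hd i) (hd j) (hχ i) (hχ j) (hfree i j hij)
  have h0 : 0 < (⨁ E).dim := by
    rw [AndreRiemann.dim_biproduct_fin E, Finset.sum_congr rfl fun j _ => hE1 j]
    simp
  have hmt := mtRank_hodge_one_eq_card_add_one_of_isIsogenous_biproduct_elliptic (C := Fin (m + 1)) hE1 hcm hniso (cls := id)
    Function.surjective_id hY (IsIsogenous.refl _)
  rw [Fintype.card_fin, mtRank_hodge_one_eq_finrank_hodgeLie_add_one hY h0] at hmt
  have hfin : Module.finrank ℚ (BettiUniverse.hodge exists_isReal_hodgeModel_holds hY 1).hodgeLie = m + 1 := by omega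
  refine ⟨Submodule.eq_of_le_of_finrank_le hle ?_, hfin⟩
  rw [hfin]
  have h := finrank_range_le_card (R := ℚ) b
  rw [Fintype.card_fin] at h
  exact h

/-- **`Lie Hg(H¹(E₀ × ⋯ × E_m))` is ABELIAN of dimension `m + 1`** for CM elliptic curves with pairwise non-square ratios `d_i/d_j` (it is spanned by the
pairwise-annihilating blocks `χ̂_j`; `Hg = ∏_j U_{k_j}`, Kubota). [cite: MoonenZarhin1999LowDim, §3 Prop. (3.8)] [cite: Gordon1999HodgeAVSurvey, 7.5 and 7.6.1] -/
theorem hodgeLie_hodge_one_biproduct_cmCurves_comm_and_finrank (hY : IsSmoothProjective k (⨁ E).X) (hE1 : ∀ j, (E j).dim = 1)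
    (χ : ∀ j, E j ⟶ E j) (d : Fin (m + 1) → ℕ) (hd : ∀ j, 0 < d j) (hχ : ∀ j, χ j ≫ χ j = -(d j • 𝟙 (E j)))
    (hfree : ∀ i j, i ≠ j → ∀ s : ℚ, (d i : ℚ) ≠ s ^ 2 * d j) :
    haveI := BettiUniverse.finite hY 1
    (∀ a ∈ (BettiUniverse.hodge exists_isReal_hodgeModel_holds hY 1).hodgeLie, ∀ a' ∈ (BettiUniverse.hodge exists_isReal_hodgeModel_holds hY 1).hodgeLie,
        a * a' = a' * a) ∧
      Module.finrank ℚ (BettiUniverse.hodge exists_isReal_hodgeModel_holds hY 1).hodgeLie = m + 1 := by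
  classical
  haveI := BettiUniverse.finite hY 1
  obtain ⟨hspan, hfin⟩ := hodgeLie_hodge_one_biproduct_cmCurves_eq_span hY hE1 χ d hd hχ hfree
  refine ⟨fun a ha a' ha' => ?_, hfin⟩
  set b : Fin (m + 1) → Module.End ℚ (bettiCohomology (⨁ E).X 1) := fun j =>
    BettiUniverse.pull (biproduct.π E j).hom.hom.hom 1 ∘ₗ (bettiCohomology.map (χ j).hom.hom.hom 1).hom ∘ₗ
      BettiUniverse.pull (biproduct.ι E j).hom.hom.hom 1 with hb
  have hbb : ∀ i j, i ≠ j → b i * b j = 0 := by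
    intro i j hij
    refine LinearMap.ext fun v => ?_
    simp only [hb, Module.End.mul_apply, LinearMap.comp_apply, LinearMap.zero_apply]
    rw [pull_biproduct_ι_π_ne E hij, map_zero, map_zero]
  rw [hspan] at ha ha'
  obtain ⟨x, rfl⟩ := (Submodule.mem_span_range_iff_exists_fun ℚ).1 ha
  obtain ⟨y, rfl⟩ := (Submodule.mem_span_range_iff_exists_fun ℚ).1 ha'
  rw [Finset.sum_mul, Finset.sum_mul]
  refine Finset.sum_congr rfl fun i _ => ?_
  rw [Finset.mul_sum, Finset.mul_sum]
  refine Finset.sum_congr rfl fun j _ => ?_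
  rw [smul_mul_smul_comm, smul_mul_smul_comm, mul_comm (x i) (y j)]
  by_cases hij : i = j
  · subst hij; rfl
  · rw [hbb i j hij, smul_zero, smul_zero]

/-! ## §2 Twisted rigidity of the CM-torus summand -/

/-- **Twisted rigidity of `Lie Hg(H¹(E₀ × ⋯ × E_m))`** (CM elliptic curves, `χ_j ∘ χ_j = −d_j`, pairwise non-square ratios): for a Hodge operator `Θ`
of `H¹(⨁ E)`, a rational `T ≠ 0`, `d > 0` and `r ∈ ℚ` with `r = 0` or `d ≠ s² d_j` for all `j`, `s`, a rational subspace `K ≤ Lie Hg` and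
`y₀ ∈ Lie Hg`: **`T·Θ − (2i√d·r)·(y₀)_ℂ ∈ K_ℂ ⟹ Lie Hg ≤ K`** — no proper rational subspace carries the resonance of Moonen–Zarhin's Lemma (3.6)
against a centre `ℚφ` with `φ² = −d` (`tr(Θ_A φ) = 2i√d(n₊ − n₋)`, `tr(φ²) = T`).  The trace functionals `Z ↦ tr(Z χ̂_j,ℂ)` turn the resonance
into a vanishing rational combination of `√d_0, …, √d_m, √d` (Besicovitch, `CorCM/MumfordTateRankSquareRootsIndependent`).
[cite: MoonenZarhin1999LowDim, §3 Lemma (3.6) and Prop. (3.8)] [cite: Besicovitch1940, Thm. 1] [cite: Deligne1982HodgeCycles, I §3 Prop. 3.6] -/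
theorem hodgeLie_hodge_one_biproduct_cmCurves_le_of_resonance (hY : IsSmoothProjective k (⨁ E).X) (hE1 : ∀ j, (E j).dim = 1)
    (χ : ∀ j, E j ⟶ E j) (d : Fin (m + 1) → ℕ) (hd : ∀ j, 0 < d j) (hχ : ∀ j, χ j ≫ χ j = -(d j • 𝟙 (E j)))
    (hfree : ∀ i j, i ≠ j → ∀ s : ℚ, (d i : ℚ) ≠ s ^ 2 * d j)
    {Θ : Module.End ℂ (ℂ ⊗[ℚ] bettiCohomology (⨁ E).X 1)}
    (hΘ : haveI := BettiUniverse.finite hY 1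
      ∀ p, ∀ x ∈ (BettiUniverse.hodge exists_isReal_hodgeModel_holds hY 1).piece p (((1 : ℕ) : ℤ) - p),
        Θ x = ((2 * p - ((1 : ℕ) : ℤ) : ℤ) : ℂ) • x)
    {T : ℚ} (hT : T ≠ 0) {d₀ : ℕ} (hd₀ : 0 < d₀) {r : ℚ} (hr : r = 0 ∨ ∀ j, ∀ s : ℚ, (d₀ : ℚ) ≠ s ^ 2 * d j)
    (K : Submodule ℚ (Module.End ℚ (bettiCohomology (⨁ E).X 1)))
    (hK : haveI := BettiUniverse.finite hY 1
      K ≤ (BettiUniverse.hodge exists_isReal_hodgeModel_holds hY 1).hodgeLie)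
    {y₀ : Module.End ℚ (bettiCohomology (⨁ E).X 1)}
    (hy₀ : haveI := BettiUniverse.finite hY 1
      y₀ ∈ (BettiUniverse.hodge exists_isReal_hodgeModel_holds hY 1).hodgeLie)
    (hmem : ((T : ℚ) : ℂ) • Θ - (2 * (Complex.I * (Real.sqrt d₀ : ℂ)) * (r : ℂ)) • y₀.baseChange ℂ ∈ spanC K) :
    haveI := BettiUniverse.finite hY 1
    (BettiUniverse.hodge exists_isReal_hodgeModel_holds hY 1).hodgeLie ≤ K := by
  classical
  have hkY : (⨁ E).dim = k := schemeDim_eq_holds hY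
  subst hkY
  haveI := BettiUniverse.finite hY 1
  have hEsp : ∀ j, IsSmoothProjective (E j).dim (E j).X := fun j => AbelianVariety.isSmoothProjective_holds
  haveI : ∀ j, Module.Finite ℚ (bettiCohomology (E j).X 1) := fun j => BettiUniverse.finite (hEsp j) 1
  obtain ⟨hspan, -⟩ := hodgeLie_hodge_one_biproduct_cmCurves_eq_span hY hE1 χ d hd hχ hfree
  let ιY : ∀ j, Hom (BettiUniverse.hodge exists_isReal_hodgeModel_holds (hEsp j) 1) (BettiUniverse.hodge exists_isReal_hodgeModel_holds hY 1) :=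
    fun j => BettiUniverse.pullHodgeHom exists_isReal_hodgeModel_holds hodgePQ_independent_of_hodgeModel_holds hY (hEsp j)
      (biproduct.π E j).hom.hom.hom 1
  let πY : ∀ j, Hom (BettiUniverse.hodge exists_isReal_hodgeModel_holds hY 1) (BettiUniverse.hodge exists_isReal_hodgeModel_holds (hEsp j) 1) :=
    fun j => BettiUniverse.pullHodgeHom exists_isReal_hodgeModel_holds hodgePQ_independent_of_hodgeModel_holds (hEsp j) hY
      (biproduct.ι E j).hom.hom.hom 1
  have hπι : ∀ j v, (πY j).toLinearMap ((ιY j).toLinearMap v) = v := fun j v => pull_biproduct_ι_π_self E j v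
  have hπιc : ∀ j, (πY j).toLinearMap ∘ₗ (ιY j).toLinearMap = LinearMap.id := fun j => LinearMap.ext (hπι j)
  have hπι' : ∀ i j, i ≠ j → ∀ v, (πY i).toLinearMap ((ιY j).toLinearMap v) = 0 := fun i j hij v => pull_biproduct_ι_π_ne E hij v
  set χQ : ∀ j, Module.End ℚ (bettiCohomology (E j).X 1) := fun j => (bettiCohomology.map (χ j).hom.hom.hom 1).hom with hχQ
  set b : Fin (m + 1) → Module.End ℚ (bettiCohomology (⨁ E).X 1) := fun j =>
    BettiUniverse.pull (biproduct.π E j).hom.hom.hom 1 ∘ₗ (bettiCohomology.map (χ j).hom.hom.hom 1).hom ∘ₗ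
      BettiUniverse.pull (biproduct.ι E j).hom.hom.hom 1 with hb
  have hbj : ∀ j, b j = (ιY j).toLinearMap ∘ₗ χQ j ∘ₗ (πY j).toLinearMap := fun j => rfl
  have hχ2 : ∀ j, χQ j * χQ j = -((d j : ℚ) • 1) := fun j => bettiMapHom_mul_self (hχ j)
  have hb𝔥 : ∀ j, b j ∈ (BettiUniverse.hodge exists_isReal_hodgeModel_holds hY 1).hodgeLie := fun j => by
    rw [hspan]; exact Submodule.subset_span ⟨j, rfl⟩
  have hbb : ∀ i j, i ≠ j → b i * b j = 0 := by
    intro i j hij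
    refine LinearMap.ext fun v => ?_
    simp only [hbj, Module.End.mul_apply, LinearMap.comp_apply, LinearMap.zero_apply]
    rw [hπι' i j hij, map_zero, map_zero]
  have htr : ∀ j, LinearMap.trace ℚ _ (b j * b j) = -(2 * (d j : ℚ)) := by
    intro j
    have h : b j * b j = (ιY j).toLinearMap ∘ₗ ((χQ j * χQ j) ∘ₗ (πY j).toLinearMap) := by
      rw [hbj, Module.End.mul_eq_comp, Module.End.mul_eq_comp]
      refine LinearMap.ext fun v => ?_
      simp only [LinearMap.comp_apply, hπι]
    rw [h, LinearMap.trace_comp_comm', LinearMap.comp_assoc, hπιc j, LinearMap.comp_id, trace_pullback_mul_self_eq (χ j) (hχ j), hE1 j]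
    push_cast
    ring
  have htr' : ∀ i j, LinearMap.trace ℚ _ (b i * b j) = if i = j then -(2 * (d j : ℚ)) else 0 := by
    intro i j
    by_cases hij : i = j
    · subst hij; rw [if_pos rfl, htr]
    · rw [if_neg hij, hbb i j hij, map_zero]
  have htr0 : ∀ j, LinearMap.trace ℚ _ (b j * b j) ≠ 0 := fun j => by
    rw [htr j]
    have : (d j : ℚ) ≠ 0 := by exact_mod_cast (hd j).ne'
    exact neg_ne_zero.2 (mul_ne_zero two_ne_zero this)
  by_contra hnot
  obtain ⟨v, hv𝔥, hvK⟩ := Set.not_subset.1 hnot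
  obtain ⟨f, hfv, hKf⟩ := Submodule.exists_le_ker_of_notMem hvK
  set w : Fin (m + 1) → ℚ := fun j => f (b j) / LinearMap.trace ℚ _ (b j * b j) with hw
  have hlam : ∀ X ∈ (BettiUniverse.hodge exists_isReal_hodgeModel_holds hY 1).hodgeLie,
      ∑ j, w j * LinearMap.trace ℚ _ (X * b j) = f X := by
    intro X hX
    rw [hspan] at hX
    obtain ⟨x, rfl⟩ := (Submodule.mem_span_range_iff_exists_fun ℚ).1 hX
    rw [map_sum]
    refine Finset.sum_congr rfl fun j _ => ?_
    rw [Finset.sum_mul, map_sum, Finset.sum_eq_single j (fun i _ hij => by rw [smul_mul_assoc, map_smul, hbb i j hij, map_zero, smul_zero])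
      (fun h => (h (Finset.mem_univ j)).elim), smul_mul_assoc, map_smul, map_smul, smul_eq_mul, smul_eq_mul, hw]
    field_simp [htr0 j]
  set Λ : Module.End ℂ (ℂ ⊗[ℚ] bettiCohomology (⨁ E).X 1) →ₗ[ℂ] ℂ :=
    ∑ j, (w j : ℂ) • ((LinearMap.trace ℂ (ℂ ⊗[ℚ] bettiCohomology (⨁ E).X 1)).comp (LinearMap.mulRight ℂ ((b j).baseChange ℂ))) with hΛ
  have hΛapp : ∀ Z, Λ Z = ∑ j, (w j : ℂ) * LinearMap.trace ℂ _ (Z * (b j).baseChange ℂ) := fun Z => by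
    simp only [hΛ, LinearMap.sum_apply, LinearMap.smul_apply, LinearMap.comp_apply, LinearMap.mulRight_apply, smul_eq_mul]
  have hΛQ : ∀ X : Module.End ℚ (bettiCohomology (⨁ E).X 1),
      Λ (X.baseChange ℂ) = ((∑ j, w j * LinearMap.trace ℚ _ (X * b j) : ℚ) : ℂ) := by
    intro X
    rw [hΛapp]
    push_cast
    refine Finset.sum_congr rfl fun j _ => ?_
    rw [← LinearMap.baseChange_mul, LinearMap.trace_baseChange, eq_ratCast]
  have hΛK : ∀ Z ∈ spanC K, Λ Z = 0 := by
    intro Z hZ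
    have hle : spanC K ≤ LinearMap.ker Λ := by
      refine Submodule.span_le.2 ?_
      rintro _ ⟨X, hX, rfl⟩
      rw [SetLike.mem_coe, LinearMap.mem_ker, hΛQ, hlam X (hK hX), show f X = 0 from LinearMap.mem_ker.1 (hKf hX), Rat.cast_zero]
    exact LinearMap.mem_ker.1 (hle hZ)
  have hΘtr : ∀ j, LinearMap.trace ℂ _ (Θ * (b j).baseChange ℂ) =
      2 * (Complex.I * (Real.sqrt (d j) : ℂ)) *
        ((eigenMultiplicity (E j) (χ j) (Complex.I * (Real.sqrt (d j) : ℂ)) : ℂ) -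
          (eigenMultiplicity (E j) (χ j) (-(Complex.I * (Real.sqrt (d j) : ℂ))) : ℂ)) := by
    intro j
    set Θj := (πY j).toLinearMap.baseChange ℂ ∘ₗ Θ ∘ₗ (ιY j).toLinearMap.baseChange ℂ with hΘjdef
    have hΘj : ∀ p, ∀ x ∈ (BettiUniverse.hodge exists_isReal_hodgeModel_holds (hEsp j) 1).piece p (((1 : ℕ) : ℤ) - p),
        Θj x = ((2 * p - ((1 : ℕ) : ℤ) : ℤ) : ℂ) • x := by
      intro p x hx
      have hιx : (ιY j).toLinearMap.baseChange ℂ x ∈ (BettiUniverse.hodge exists_isReal_hodgeModel_holds hY 1).piece p (((1 : ℕ) : ℤ) - p) :=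
        (ιY j).map_piece_le p _ ⟨x, hx, rfl⟩
      rw [hΘjdef, LinearMap.comp_apply, LinearMap.comp_apply, hΘ p _ hιx, map_smul, ← LinearMap.comp_apply,
        ← LinearMap.baseChange_comp, hπιc j, LinearMap.baseChange_id, LinearMap.id_apply]
    have ht : LinearMap.trace ℂ _ (Θ * (b j).baseChange ℂ) = LinearMap.trace ℂ _ (Θj * (χQ j).baseChange ℂ) := by
      rw [hbj, LinearMap.baseChange_comp, LinearMap.baseChange_comp, Module.End.mul_eq_comp, Module.End.mul_eq_comp,
        ← LinearMap.comp_assoc, ← LinearMap.comp_assoc, LinearMap.trace_comp_comm', hΘjdef]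
      simp only [LinearMap.comp_assoc]
    rw [ht]
    exact trace_theta_mul_baseChange_pullback_eq exists_isReal_hodgeModel_holds hodgePQ_independent_of_hodgeModel_holds (χ j) (hd j) (hχ j) hΘj
  set ε : Fin (m + 1) → ℚ := fun j =>
    (eigenMultiplicity (E j) (χ j) (Complex.I * (Real.sqrt (d j) : ℂ)) : ℚ) - (eigenMultiplicity (E j) (χ j) (-(Complex.I * (Real.sqrt (d j) : ℂ))) : ℚ)
    with hε
  have hε0 : ∀ j, ε j ≠ 0 := by
    intro j
    have hs := eigenMultiplicity_add_eigenMultiplicity_neg_eq_dim (E j) (χ j) (hd j) (hχ j)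
    rw [hE1 j] at hs
    intro h0
    rw [hε, sub_eq_zero] at h0
    have : eigenMultiplicity (E j) (χ j) (Complex.I * (Real.sqrt (d j) : ℂ)) = eigenMultiplicity (E j) (χ j) (-(Complex.I * (Real.sqrt (d j) : ℂ))) := by
      exact_mod_cast h0
    omega
  set F : ℚ := ∑ j, w j * LinearMap.trace ℚ _ (y₀ * b j) with hF
  have hrel0 := hΛK _ hmem
  rw [map_sub, map_smul, map_smul, hΛQ y₀, hΛapp, smul_eq_mul, smul_eq_mul] at hrel0
  simp only [hΘtr] at hrel0
  set S : ℂ := ∑ j, ((w j * ε j : ℚ) : ℂ) * (Real.sqrt (d j) : ℂ) with hSdef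
  have hsumeq : ∑ j, (w j : ℂ) * (2 * (Complex.I * (Real.sqrt (d j) : ℂ)) *
      ((eigenMultiplicity (E j) (χ j) (Complex.I * (Real.sqrt (d j) : ℂ)) : ℂ) -
        (eigenMultiplicity (E j) (χ j) (-(Complex.I * (Real.sqrt (d j) : ℂ))) : ℂ))) = (2 * Complex.I) * S := by
    rw [hSdef, Finset.mul_sum]
    refine Finset.sum_congr rfl fun j _ => ?_
    rw [hε]
    push_cast
    ring
  rw [hsumeq, ← hF] at hrel0
  have hrel : ∑ j, (((T * w j * ε j : ℚ) : ℂ) * (Real.sqrt (d j) : ℂ)) + ((-(r * F) : ℚ) : ℂ) * (Real.sqrt d₀ : ℂ) = 0 := by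
    have hS : ∑ j, (((T * w j * ε j : ℚ) : ℂ) * (Real.sqrt (d j) : ℂ)) = (T : ℂ) * S := by
      rw [hSdef, Finset.mul_sum]
      refine Finset.sum_congr rfl fun j _ => ?_
      push_cast
      ring
    have key : (2 * Complex.I) * ((T : ℂ) * S + ((-(r * F) : ℚ) : ℂ) * (Real.sqrt d₀ : ℂ)) = 0 := by
      rw [← hrel0]
      push_cast
      ring
    rw [hS]
    exact (mul_eq_zero.1 key).resolve_left (mul_ne_zero two_ne_zero Complex.I_ne_zero)
  have hcoef : ∀ j, T * w j * ε j = 0 := by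
    rcases hr with hr0 | hfree₀
    · -- `r = 0`: a relation among the `√d_j` only
      have hrel' : ∑ j, (((T * w j * ε j : ℚ) : ℂ) * (Real.sqrt (d j) : ℂ)) = 0 := by
        rw [hr0, zero_mul, neg_zero, Rat.cast_zero, zero_mul, add_zero] at hrel
        exact hrel
      exact eq_zero_of_sum_ratCast_mul_sqrt_eq_zero_family_complex d hd hfree _ hrel'
    · -- the family `(d₀, d_0, …, d_m)` indexed by `Option (Fin (m+1))`
      let d' : Option (Fin (m + 1)) → ℕ := fun o => Option.elim o d₀ d
      have hd'pos : ∀ o, 0 < d' o := by rintro (_ | j); exacts [hd₀, hd j]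
      have hd'free : ∀ o o', o ≠ o' → ∀ s : ℚ, (d' o : ℚ) ≠ s ^ 2 * d' o' := by
        rintro (_ | i) (_ | j) hoo' s
        · exact absurd rfl hoo'
        · show (d₀ : ℚ) ≠ s ^ 2 * (d j : ℚ)
          exact hfree₀ j s
        · show (d i : ℚ) ≠ s ^ 2 * (d₀ : ℚ)
          exact forall_ne_sq_mul_symm (hd i) (hfree₀ i) s
        · show (d i : ℚ) ≠ s ^ 2 * (d j : ℚ)
          exact hfree i j (fun h => hoo' (congrArg some h)) s
      let c' : Option (Fin (m + 1)) → ℚ := fun o => Option.elim o (-(r * F)) (fun j => T * w j * ε j)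
      have hrel' : ∑ o, ((c' o : ℚ) : ℂ) * (Real.sqrt (d' o) : ℂ) = 0 := by
        rw [Fintype.sum_option]
        show ((-(r * F) : ℚ) : ℂ) * (Real.sqrt d₀ : ℂ) + ∑ j, ((T * w j * ε j : ℚ) : ℂ) * (Real.sqrt (d j) : ℂ) = 0
        rw [add_comm]
        exact hrel
      have h := eq_zero_of_sum_ratCast_mul_sqrt_eq_zero_family_complex d' hd'pos hd'free c' hrel'
      exact fun j => h (some j)
  have hw0 : ∀ j, w j = 0 := fun j => by
    have h := hcoef j
    rcases mul_eq_zero.1 h with h | h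
    · rcases mul_eq_zero.1 h with h | h
      · exact absurd h hT
      · exact h
    · exact absurd h (hε0 j)
  have hfv0 : f v = 0 := by
    rw [← hlam v hv𝔥]
    simp [hw0]
  exact hfv hfv0

end Summit.HodgeConjecture.CorCM

end
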